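import Mathlib.InformationTheory.Hamming
import Mathlib.Algebra.Order.Floor.Div
import Mathlib.LinearAlgebra.FiniteDimensional.Lemmas
import Mathlib.LinearAlgebra.Pi
import HarnessLib

/-!
# The Griesmer bound for linear codes

Topic `Literature/InformationTheory/Coding` (next to `DualDistance.lean`, which introduces linear
codes `C ≤ F^ι` as `Submodule F (ι → F)` with Mathlib's `hammingNorm`). Everything here is PROVED;
no definitions of mathematical content, no named facts.

**Griesmer bound** (Griesmer 1960; as printed in Bürgisser–Clausen–Shokrollahi, *Algebraic
Complexity Theory* (1997), §18.1, with proof as Ex. 18.2): an `[n, k, d]_q` linear code satisfies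
«`n ≥ ∑_{i=0}^{k-1} ⌈d / q^i⌉`», hence «`N_q[k,d] ≥ ∑_{i=0}^{k-1} ⌈d/q^i⌉`» where `N_q[k,d]` is the least
block length of a linear code over `𝔽_q` of dimension `k` and minimum distance `d`.

We prove it in the form: for a finite field `F` with `q` elements, a finite index type `ι` and a
subspace `C ≤ F^ι` all of whose nonzero vectors have Hamming weight `≥ d`,
`∑_{i < dim C} ⌈d / q^i⌉ ≤ |ι|` (`griesmer_bound`; ceiling division is Mathlib's `⌈/⌉` on `ℕ`).
The proof is the standard residual-code induction (van Lint, *Introduction to Coding Theory*,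
§5.2; BCS Ex. 18.2): take a nonzero codeword `c` of minimum weight `w`; puncturing on the support
of `c` gives a code of length `|ι| - w`, dimension `dim C - 1` (the kernel of the projection on `C`
is the line `F c`) and minimum weight `≥ ⌈w/q⌉`; both facts come from the same count: for a codeword
`y`, `∑_{λ ∈ F} wt(y - λ c) = q · wt(y|_{c = 0}) + (q - 1) · w`, while each `y - λ c ≠ 0` has weight
`≥ w`.

Used in `Literature/Computability/AlgebraicComplexity/BrockettDobkinCodes.lean` (Brockett–Dobkin
codes of bilinear computations; BCS Cor. (18.14): `R(𝔽_q^{n×n}) ≥ N_q[n, n²]`, e.g. `≥ 17` for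
`3 × 3` matrices over `𝔽₂` by `9 + 5 + 3`).

HONEST FRAMING: a classical 1960 bound, typed from BCS 1997 §18.1 (held text, chunk p0522);
nothing new.

## References

* J. H. Griesmer, *A bound for error-correcting codes*, IBM J. Res. Develop. 4 (1960) 532–542
  (BCS ref. [204]). [BurgisserClausenShokrollahi1997]
* P. Bürgisser, M. Clausen, M. A. Shokrollahi, *Algebraic Complexity Theory*, Grundlehren 315,
  Springer 1997, §18.1 (Griesmer bound), Ex. 18.2. [BurgisserClausenShokrollahi1997]
* J. H. van Lint, *Introduction to Coding Theory*, 3rd ed., Springer GTM 86, §5.2 (residual code).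
-/

namespace Literature.InformationTheory.Coding

open Module Finset

variable {F : Type*} [Field F] [DecidableEq F]
variable {ι : Type*} [Fintype ι]

/-! ### Counting lemmas -/

/-- The weight of a vector splits along any predicate on the coordinates (helper). [folklore] -/
private theorem hammingNorm_eq_card_add_card (x : ι → F) (p : ι → Prop) [DecidablePred p] :
    hammingNorm x = #{i | p i ∧ x i ≠ 0} + #{i | ¬ p i ∧ x i ≠ 0} := by
  unfold hammingNorm
  rw [← card_filter_add_card_filter_not (s := ({i | x i ≠ 0} : Finset ι)) p]
  congr 1
  · congr 1; ext i; simp [and_comm]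
  · congr 1; ext i; simp [and_comm]

section FiniteField

variable [Fintype F]

/-- For `c_i ≠ 0`, exactly `q - 1` scalars `λ` have `y_i - λ c_i ≠ 0` (helper). [folklore] -/
private theorem card_filter_sub_mul_ne_zero {a b : F} (hb : b ≠ 0) :
    #{l : F | a - l * b ≠ 0} = Fintype.card F - 1 := by
  have : ({l : F | a - l * b ≠ 0} : Finset F) = univ.erase (a / b) := by
    rw [← filter_ne']
    congr 1; ext l
    simp only [ne_eq, sub_eq_zero]
    constructor
    · intro h hl; exact h (by rw [hl, div_mul_cancel₀ a hb])
    · intro h hl; exact h (by rw [hl, mul_div_cancel_right₀ l hb])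
  rw [this, card_erase_of_mem (mem_univ _), card_univ]

/-- The basic count behind the Griesmer step: summing, over all scalars `λ`, the number of
support positions of `c` at which `y - λ c` does not vanish gives `(q - 1) · wt c`.
[cite: BurgisserClausenShokrollahi1997, §18.1, Ex. 18.2] -/
theorem sum_card_support_sub_smul (c y : ι → F) :
    ∑ l : F, #{i | c i ≠ 0 ∧ y i - l * c i ≠ 0} = (Fintype.card F - 1) * hammingNorm c := by
  calc ∑ l : F, #{i | c i ≠ 0 ∧ y i - l * c i ≠ 0}
      = ∑ l : F, ∑ i, if c i ≠ 0 ∧ y i - l * c i ≠ 0 then 1 else 0 := by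
        refine sum_congr rfl fun l _ => ?_
        rw [card_filter]
    _ = ∑ i, ∑ l : F, if c i ≠ 0 ∧ y i - l * c i ≠ 0 then 1 else 0 := sum_comm
    _ = ∑ i, if c i ≠ 0 then Fintype.card F - 1 else 0 := by
        refine sum_congr rfl fun i _ => ?_
        by_cases hc : c i = 0
        · simp [hc]
        · rw [if_pos hc]
          rw [← card_filter_sub_mul_ne_zero (a := y i) hc, card_filter]
          refine sum_congr rfl fun l _ => ?_
          simp [hc]
    _ = (Fintype.card F - 1) * hammingNorm c := by
        rw [← sum_filter, sum_const, smul_eq_mul, mul_comm]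
        rfl

end FiniteField

/-- Weight of `y - λ c` = (weight of `y` off the support of `c`) + (number of support positions of
`c` where `y_i ≠ λ c_i`) (helper). [folklore] -/
private theorem hammingNorm_sub_smul_eq (c y : ι → F) (l : F) :
    hammingNorm (y - l • c) = #{i | c i = 0 ∧ y i ≠ 0} + #{i | c i ≠ 0 ∧ y i - l * c i ≠ 0} := by
  rw [hammingNorm_eq_card_add_card (y - l • c) (fun i => c i = 0)]
  congr 1
  · congr 1; ext i
    simp only [mem_filter, mem_univ, true_and, Pi.sub_apply, Pi.smul_apply, smul_eq_mul]
    constructor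
    · rintro ⟨h1, h2⟩; exact ⟨h1, by simpa [h1] using h2⟩
    · rintro ⟨h1, h2⟩; exact ⟨h1, by simpa [h1] using h2⟩

/-! ### The residual code (Griesmer step) -/

section Step

variable (c : ι → F)

/-- Puncturing on the support of `c`: the projection `F^ι → F^{{i | c_i = 0}}` (the "residual code"
map of the Griesmer step). [cite: BurgisserClausenShokrollahi1997, §18.1 (Griesmer bound), Ex. 18.2] -/
abbrev offSupport : (ι → F) →ₗ[F] ({i // c i = 0} → F) := LinearMap.funLeft F F Subtype.val

/-- The weight of the punctured vector is the weight of `y` off the support of `c`.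
[cite: BurgisserClausenShokrollahi1997, §18.1 (Griesmer bound), Ex. 18.2] -/
theorem hammingNorm_offSupport (y : ι → F) :
    hammingNorm (offSupport c y) = #{i | c i = 0 ∧ y i ≠ 0} := by
  unfold hammingNorm
  rw [← Fintype.card_subtype, ← Fintype.card_subtype]
  exact Fintype.card_congr (Equiv.subtypeSubtypeEquivSubtypeInter (fun i => c i = 0) fun i => y i ≠ 0)

/-- The length of the residual code: `|{i | c_i = 0}| + wt c = |ι|`.
[cite: BurgisserClausenShokrollahi1997, §18.1 (Griesmer bound), Ex. 18.2] -/
theorem card_offSupport_add_hammingNorm :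
    Fintype.card {i // c i = 0} + hammingNorm c = Fintype.card ι := by
  rw [Fintype.card_subtype]
  unfold hammingNorm
  rw [← card_univ (α := ι), ← card_filter_add_card_filter_not (s := (univ : Finset ι)) (fun i => c i = 0)]

variable {c}
variable [Fintype F] {C : Submodule F (ι → F)} {w : ℕ}

/-- **Residual distance.** If `c ∈ C` has weight `w` and every nonzero codeword has weight `≥ w`
(so `c` is a minimum-weight codeword), then every codeword `y` whose puncture is nonzero satisfies
`w ≤ q · wt(y|_{c=0})`, i.e. the residual code has minimum weight `≥ ⌈w/q⌉`.
[cite: BurgisserClausenShokrollahi1997, §18.1 (Griesmer bound), Ex. 18.2] -/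
theorem le_card_mul_hammingNorm_offSupport (hcC : c ∈ C) (hcw : hammingNorm c = w)
    (hmin : ∀ x ∈ C, x ≠ 0 → w ≤ hammingNorm x) {y : ι → F} (hy : y ∈ C)
    (hy0 : offSupport c y ≠ 0) :
    w ≤ Fintype.card F * hammingNorm (offSupport c y) := by
  -- every `y - l c` is a nonzero codeword
  have hne : ∀ l : F, y - l • c ≠ 0 := by
    intro l h
    apply hy0
    have : offSupport c (y - l • c) = offSupport c y := by
      ext ⟨i, hi⟩
      simp [hi]
    rw [← this, h, map_zero]
  have hge : ∀ l : F, w ≤ hammingNorm (y - l • c) :=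
    fun l => hmin _ (C.sub_mem hy (C.smul_mem l hcC)) (hne l)
  have hsum : Fintype.card F * w ≤
      Fintype.card F * hammingNorm (offSupport c y) + (Fintype.card F - 1) * w := by
    calc Fintype.card F * w = ∑ _l : F, w := by rw [sum_const, card_univ, smul_eq_mul]
      _ ≤ ∑ l : F, hammingNorm (y - l • c) := sum_le_sum fun l _ => hge l
      _ = ∑ l : F, (#{i | c i = 0 ∧ y i ≠ 0} + #{i | c i ≠ 0 ∧ y i - l * c i ≠ 0}) :=
          sum_congr rfl fun l _ => hammingNorm_sub_smul_eq c y l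
      _ = Fintype.card F * hammingNorm (offSupport c y) + (Fintype.card F - 1) * w := by
          rw [sum_add_distrib, sum_const, card_univ, smul_eq_mul, sum_card_support_sub_smul,
            hcw, hammingNorm_offSupport]
  -- `q w ≤ q w' + (q-1) w` gives `w ≤ q w'`
  have hq : 1 ≤ Fintype.card F := Fintype.card_pos
  have : (Fintype.card F - 1) * w + w = Fintype.card F * w := by
    rw [Nat.sub_one_mul, Nat.sub_add_cancel (Nat.le_mul_of_pos_left w hq)]
  omega

/-- **Residual dimension.** Under the same hypotheses (and `c ≠ 0`), a codeword vanishing off the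
support of `c` is a multiple of `c`: the kernel of the puncturing map on `C` is the line `F c`.
[cite: BurgisserClausenShokrollahi1997, §18.1 (Griesmer bound), Ex. 18.2] -/
theorem exists_eq_smul_of_offSupport_eq_zero (hcC : c ∈ C) (hc0 : c ≠ 0)
    (hcw : hammingNorm c = w) (hmin : ∀ x ∈ C, x ≠ 0 → w ≤ hammingNorm x) {x : ι → F} (hx : x ∈ C)
    (hx0 : offSupport c x = 0) : ∃ l : F, x = l • c := by
  by_contra hcon
  have hne : ∀ l : F, x - l • c ≠ 0 := fun l h => hcon ⟨l, sub_eq_zero.1 h⟩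
  have hge : ∀ l : F, w ≤ hammingNorm (x - l • c) :=
    fun l => hmin _ (C.sub_mem hx (C.smul_mem l hcC)) (hne l)
  have hoff : #{i | c i = 0 ∧ x i ≠ 0} = 0 := by
    rw [← hammingNorm_offSupport, hx0, hammingNorm_zero]
  have hsum : Fintype.card F * w ≤ (Fintype.card F - 1) * w := by
    calc Fintype.card F * w = ∑ _l : F, w := by rw [sum_const, card_univ, smul_eq_mul]
      _ ≤ ∑ l : F, hammingNorm (x - l • c) := sum_le_sum fun l _ => hge l
      _ = ∑ l : F, (#{i | c i = 0 ∧ x i ≠ 0} + #{i | c i ≠ 0 ∧ x i - l * c i ≠ 0}) :=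
          sum_congr rfl fun l _ => hammingNorm_sub_smul_eq c x l
      _ = (Fintype.card F - 1) * w := by
          rw [sum_add_distrib, hoff, sum_const_zero, zero_add, sum_card_support_sub_smul, hcw]
  have hw : 0 < w := by
    rw [← hcw]; exact hammingNorm_pos_iff.2 hc0
  have hq : 1 ≤ Fintype.card F := Fintype.card_pos
  have : (Fintype.card F - 1) * w + w = Fintype.card F * w := by
    rw [Nat.sub_one_mul, Nat.sub_add_cancel (Nat.le_mul_of_pos_left w hq)]
  omega

/-- The residual code `C' = C|_{c = 0}` has dimension `dim C - 1`.
[cite: BurgisserClausenShokrollahi1997, §18.1 (Griesmer bound), Ex. 18.2] -/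
theorem finrank_map_offSupport_add_one (hcC : c ∈ C) (hc0 : c ≠ 0)
    (hcw : hammingNorm c = w) (hmin : ∀ x ∈ C, x ≠ 0 → w ≤ hammingNorm x) :
    finrank F (C.map (offSupport c)) + 1 = finrank F C := by
  set f : C →ₗ[F] ({i // c i = 0} → F) := (offSupport c).domRestrict C with hf
  have hrange : LinearMap.range f = C.map (offSupport c) := LinearMap.range_domRestrict _ _
  have hker : LinearMap.ker f = F ∙ (⟨c, hcC⟩ : C) := by
    apply le_antisymm
    · intro x hx
      rw [LinearMap.mem_ker] at hx
      obtain ⟨l, hl⟩ := exists_eq_smul_of_offSupport_eq_zero hcC hc0 hcw hmin x.2 hx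
      rw [Submodule.mem_span_singleton]
      exact ⟨l, Subtype.ext (by simpa using hl.symm)⟩
    · rw [Submodule.span_le, Set.singleton_subset_iff, SetLike.mem_coe, LinearMap.mem_ker]
      ext ⟨i, hi⟩
      simp [hf, hi]
  have hc0' : (⟨c, hcC⟩ : C) ≠ 0 := fun h => hc0 (by simpa using congrArg Subtype.val h)
  have h := LinearMap.finrank_range_add_finrank_ker f
  rw [hrange, hker, finrank_span_singleton hc0'] at h
  exact h

end Step

/-! ### The bound -/

section Bound

variable [Fintype F]

/-- Ceiling divisions compose: `⌈⌈a/b⌉/c⌉ = ⌈a/(bc)⌉` (helper). [folklore] -/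
private theorem ceilDiv_ceilDiv (a : ℕ) {b c : ℕ} (hb : 0 < b) (hc : 0 < c) :
    a ⌈/⌉ b ⌈/⌉ c = a ⌈/⌉ (b * c) := by
  refine eq_of_forall_ge_iff fun n => ?_
  rw [ceilDiv_le_iff_le_mul hc, ceilDiv_le_iff_le_mul hb,
    ceilDiv_le_iff_le_mul (Nat.mul_pos hb hc), mul_assoc]

/-- Ceiling division is monotone in the numerator (helper). [folklore] -/
private theorem ceilDiv_le_ceilDiv_left {a a' : ℕ} (h : a ≤ a') (b : ℕ) : a ⌈/⌉ b ≤ a' ⌈/⌉ b := by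
  rw [Nat.ceilDiv_eq_add_pred_div, Nat.ceilDiv_eq_add_pred_div]
  exact Nat.div_le_div_right (by omega)

/-- The induction behind the Griesmer bound, over the dimension, for index types in a fixed
universe. [cite: BurgisserClausenShokrollahi1997, §18.1 (Griesmer bound), Ex. 18.2] -/
theorem griesmer_aux (m : ℕ) :
    ∀ {κ : Type*} [Fintype κ] (C : Submodule F (κ → F)) (w : ℕ),
      finrank F C = m → (∀ x ∈ C, x ≠ 0 → w ≤ hammingNorm x) →
      ∑ i ∈ range m, w ⌈/⌉ Fintype.card F ^ i ≤ Fintype.card κ := by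
  induction m with
  | zero => intros; simp
  | succ m ih =>
    intro κ _ C w hdim hmin
    classical
    -- a nonzero codeword of minimum weight
    have hbot : C ≠ ⊥ := by
      intro h; rw [h, finrank_bot] at hdim; exact Nat.noConfusion hdim
    obtain ⟨x₀, hx₀C, hx₀⟩ := Submodule.exists_mem_ne_zero_of_ne_bot hbot
    set S : Finset (κ → F) := {x | x ∈ C ∧ x ≠ 0} with hS
    have hSne : S.Nonempty := ⟨x₀, by simp [hS, hx₀C, hx₀]⟩
    obtain ⟨c, hcS, hcmin⟩ := S.exists_min_image hammingNorm hSne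
    simp only [hS, mem_filter, mem_univ, true_and] at hcS hcmin
    obtain ⟨hcC, hc0⟩ := hcS
    set w₀ := hammingNorm c with hw₀
    have hmin₀ : ∀ x ∈ C, x ≠ 0 → w₀ ≤ hammingNorm x := fun x hx hx0 => hcmin x ⟨hx, hx0⟩
    have hww₀ : w ≤ w₀ := hmin c hcC hc0
    -- the residual code
    have hdim' : finrank F (C.map (offSupport c)) = m := by
      have h := finrank_map_offSupport_add_one hcC hc0 hw₀.symm hmin₀
      omega
    have hq : 0 < Fintype.card F := Fintype.card_pos
    have hmin' : ∀ y ∈ C.map (offSupport c), y ≠ 0 →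
        w₀ ⌈/⌉ Fintype.card F ≤ hammingNorm y := by
      rintro _ ⟨y, hy, rfl⟩ hy0
      rw [ceilDiv_le_iff_le_mul hq]
      exact le_card_mul_hammingNorm_offSupport hcC hw₀.symm hmin₀ hy hy0
    have hIH := ih (C.map (offSupport c)) (w₀ ⌈/⌉ Fintype.card F) hdim' hmin'
    have hlen := card_offSupport_add_hammingNorm c
    -- assemble
    calc ∑ i ∈ range (m + 1), w ⌈/⌉ Fintype.card F ^ i
        ≤ ∑ i ∈ range (m + 1), w₀ ⌈/⌉ Fintype.card F ^ i :=
          sum_le_sum fun i _ => ceilDiv_le_ceilDiv_left hww₀ _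
      _ = w₀ + ∑ i ∈ range m, (w₀ ⌈/⌉ Fintype.card F) ⌈/⌉ Fintype.card F ^ i := by
          rw [sum_range_succ', pow_zero, Nat.ceilDiv_eq_add_pred_div, Nat.add_sub_cancel,
            Nat.div_one, add_comm]
          congr 1
          refine sum_congr rfl fun i _ => ?_
          rw [ceilDiv_ceilDiv _ hq (pow_pos hq i), pow_succ']
      _ ≤ w₀ + Fintype.card {i // c i = 0} := by gcongr
      _ = Fintype.card κ := by rw [add_comm, ← hlen, hw₀]

/-- **Griesmer bound** (Griesmer 1960; BCS 1997 §18.1: «`n ≥ ∑_{i=0}^{k-1} ⌈d/q^i⌉`», i.e.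
«`N_q[k,d] ≥ ∑_{i=0}^{k-1} ⌈d/q^i⌉`»). For a linear code `C ≤ F^ι` over a finite field `F` with
`q` elements whose nonzero codewords all have Hamming weight `≥ d`:
`∑_{i < dim C} ⌈d/q^i⌉ ≤ |ι|`. [cite: BurgisserClausenShokrollahi1997, §18.1 (Griesmer bound), Ex. 18.2] -/
theorem griesmer_bound (C : Submodule F (ι → F)) {d : ℕ}
    (hd : ∀ x ∈ C, x ≠ 0 → d ≤ hammingNorm x) :
    ∑ i ∈ range (finrank F C), d ⌈/⌉ Fintype.card F ^ i ≤ Fintype.card ι :=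
  griesmer_aux (finrank F C) C d rfl hd

/-- Griesmer bound for a code given by an injective generator map `γ : F^m → F^ι` (an `[|ι|, m]`
code) with all nonzero codewords of weight `≥ d`: `∑_{i<m} ⌈d/q^i⌉ ≤ |ι|`.
[cite: BurgisserClausenShokrollahi1997, §18.1 (Griesmer bound)] -/
theorem griesmer_bound_of_injective {m : ℕ} (γ : (Fin m → F) →ₗ[F] (ι → F))
    (hγ : Function.Injective γ) {d : ℕ} (hd : ∀ g : Fin m → F, g ≠ 0 → d ≤ hammingNorm (γ g)) :
    ∑ i ∈ range m, d ⌈/⌉ Fintype.card F ^ i ≤ Fintype.card ι := by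
  have hdim : finrank F (LinearMap.range γ) = m := by
    rw [LinearMap.finrank_range_of_inj hγ, finrank_fin_fun]
  have h := griesmer_bound (LinearMap.range γ) (d := d) (by
    rintro _ ⟨g, rfl⟩ hx
    exact hd g fun hg => hx (by simp [hg]))
  rwa [hdim] at h

/-- The binary case `k = 3, d = 9` used for `3 × 3` matrix multiplication over `𝔽₂`
(`9 + 5 + 3 = 17`): a binary `[n, 3, ≥ 9]` code has `n ≥ 17`.
[cite: BurgisserClausenShokrollahi1997, Cor. (18.14), Rem. (18.16)] -/
theorem seventeen_le_card_of_binary_code_three_nine (hF : Fintype.card F = 2)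
    (γ : (Fin 3 → F) →ₗ[F] (ι → F)) (hγ : Function.Injective γ)
    (hd : ∀ g : Fin 3 → F, g ≠ 0 → 9 ≤ hammingNorm (γ g)) :
    17 ≤ Fintype.card ι := by
  have h := griesmer_bound_of_injective γ hγ hd
  rw [hF] at h
  exact le_trans (by decide) h

end Bound

end Literature.InformationTheory.Coding
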